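import Literature.NumberTheory.NumberFields.AmbiguousClassNumberPrimeDegreeIndexDvd
import Literature.NumberTheory.IwasawaTheory.ClassicalMuInvariantOnePrimeProofs
import Literature.NumberTheory.IwasawaTheory.Fukuda1994Thm1Proofs
import Literature.NumberTheory.IwasawaTheory.ClassicalLambdaInvariant
import HarnessLib

/-!
# Chevalley's unit-norm-index doors in a `ℤ_p`-tower for EVERY prime `p` (`p = 2` included), with
# Fukuda's theorem discharged: `e_n = 0` (door U), resp. `e_{n+1} = e_n` (door UG), from ONE layer

Topic `NumberTheory/IwasawaTheory` (namespace = path).  THEOREMS ONLY (no definition, no named fact, no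
instance, no `sorry`).  Sequel of `ClassicalMuVanishesUnitNormIndex.lean` (door U: `p ∤ h_K`, `s` primes above
`p`, first-layer unit norm index `p^{s-1}` ⟹ `e_n = 0`) and `ClassicalMuVanishesUnitNormIndexGenerated.lean`
(door UG: exactly `s` ramified primes in `K_{n+1}/K_n`, unit norm index `p^{s-1}`, ramified classes generating
`Cl(K_n)` modulo `p` ⟹ `e_{n+1} = e_n`).  Both tree files assume `p ≠ 2` — oddness being used ONLY to get
`e_∞ = 1` in Chevalley's formula — and take Fukuda's Thm. 1 (1) (`fukuda1994_thm1_classNumberPExp_const_of_succ_eq`)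
as a HYPOTHESIS; and both ask for the EXACT index `[E : E ∩ N] · p = p^s` with the EXACT count `s`.  All three
restrictions are removed here:

* in a `ℤ_p`-tower EVERY layer `K_n/K` is unramified at the infinite places for EVERY `p`, `p = 2` included
  (complex conjugations are `2`-torsion in the torsion-free `ℤ_p`; tree
  `ZpExtension.isUnramifiedAtInfinitePlaces_layer`, Washington §13.1), hence so is `K_n/K_m`
  (`isUnramifiedAtInfinitePlaces_layer_layer`, via Mathlib `IsUnramifiedAtInfinitePlaces.top`); the number-field
  doors for any prime degree under `[IsUnramifiedAtInfinitePlaces K L]` are in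
  `NumberFields/AmbiguousClassNumberPrimeDegreeAnyPrime.lean` and `…IndexDvd.lean`;
* Fukuda's Thm. 1 (1) is a tree THEOREM (`fukuda1994_thm1_classNumberPExp_const_of_succ_eq_holds`), so every
  tower corollary below is UNCONDITIONAL;
* only the LOWER BOUND `p^s ∣ [E : E ∩ N] · p` (i.e. `p^{s-1} ∣` the index) and an UPPER bound `≤ s` on the number of
  ramified primes are asked (`NumberFields/AmbiguousClassNumberPrimeDegreeIndexDvd.lean`: with `p ∤ h_K`, resp. with
  the generation hypothesis, Chevalley's formula itself forces equality) — exactly what a certificate by `s - 1`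
  explicit non-norm units proves, with no appeal to the Hasse norm theorem.

## Main results (`K` a number field, `p` ANY prime, `κ` a `ℤ_p`-extension of `K`)

* `isUnramifiedAtInfinitePlaces_layer_layer` — `K_n/K_m` is unramified at the infinite places;
* door U: `classNumberPExp_one_eq_zero_of_pow_dvd_relIndex_mul` (`e_1 = 0`),
  **`classNumberPExp_eq_zero_of_pow_dvd_relIndex_mul`** (`n₀ = 0` ⟹ `e_n = 0` for all `n`),
  `classicalMuVanishes_of_pow_dvd_relIndex_mul`, `classicalLambda_eq_zero_of_pow_dvd_relIndex_mul`,
  `forall_classicalMuVanishes_of_pow_dvd_relIndex_mul` (consumer form «`∀ κ` cyclotomic»);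
* door UG: `classNumberPExp_one_eq_padicValNat_classNumber_of_pow_dvd_of_sup_eq_top` (`e_1 = ord_p h_K`),
  **`classNumberPExp_succ_eq_of_pow_dvd_of_sup_eq_top`** (`e_{n+1} = e_n` from the layer `K_{n+1}/K_n`),
  **`classNumberPExp_eq_of_le_of_pow_dvd_of_sup_eq_top`** (`n₀ ≤ n` ⟹ `e_m = e_n` for all `m ≥ n`),
  `classicalMuVanishes_of_pow_dvd_of_sup_eq_top` (`μ = 0`), `classicalLambda_eq_zero_of_pow_dvd_of_sup_eq_top` (`λ = 0`).

At `p = 2`: for the cyclotomic `ℤ₂`-tower of a cubic field in which `2` splits into THREE primes one has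
`e_1 ≥ e_0 + 1` (no layer-`(0,1)` door exists); door UG at the layer `K_2/K_1` (`n = 1`, `s = 3`: the three
dyadic primes of `K_1 = K(√2)` generate its `2`-class group, and two units `x, y` of `K_1` with `x`, `y`, `xy`
outside `N K_2ˣ`, i.e. `4 ∣ [E_{K_1} : E_{K_1} ∩ N K_2ˣ]`) then gives `e_m = e_1` for all `m ≥ 1`, `μ = 0`, `λ = 0`
— data of the sextic field `K_1` only.
HONEST SCOPE: classical genus theory + Fukuda; nothing specific to any summit; BSD is not advanced by this file.

## References

* S. Lang, *Cyclotomic Fields I and II*, GTM 121 (1990), Ch. 13 §4, Lemma 4.1 and sequel (PDF pp. 203–204). [Lang1990]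
* L. C. Washington, *Introduction to Cyclotomic Fields*, 2nd ed., GTM 83 (1997), §13.1 Prop. 13.2, §13.3
  Prop. 13.22. [Washington1997]
* T. Fukuda, *Remarks on `ℤ_p`-extensions of number fields*, Proc. Japan Acad. 70 A (1994), Thm. 1 (1), p. 264
  (tree theorem `fukuda1994_thm1_classNumberPExp_const_of_succ_eq_holds`). [Fukuda1994]
* R. Greenberg, *Iwasawa theory — past and present* (2001), Prop. 2.1 p. 339. [Greenberg2001IwasawaPastPresent]
-/

noncomputable section

open NumberField IsDedekindDomain
open scoped nonZeroDivisors

/-! ## §2 `ℤ_p`-towers, every prime `p`: the doors at a layer, then every later layer (Fukuda, proved) -/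

namespace Literature.NumberTheory.IwasawaTheory

open Literature.NumberTheory.EllipticCurves Literature.NumberTheory.NumberFields
  Literature.NumberTheory.NumberFields.AmbiguousClass
  Literature.NumberTheory.GaloisRepresentations Literature.NumberTheory.GaloisRepresentations.Herbrand
  Literature.NumberTheory.GaloisRepresentations.MinkowskiUnit
  Literature.NumberTheory.GaloisRepresentations.CyclicNormIndex

variable {K : Type} [Field K] [NumberField K] {p : ℕ} [Fact p.Prime]

/-- **`K_n/K_m` is unramified at the infinite places**, for every prime `p` and every `ℤ_p`-extension `κ` of a
number field `K` (whenever `K_n` is given as a `K_m`-algebra compatibly with `K`): `K_n/K` is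
(`ZpExtension.isUnramifiedAtInfinitePlaces_layer` — complex conjugations lie in `ker κ`), hence so is the top
part `K_n/K_m` of the tower `K ≤ K_m ≤ K_n` (Mathlib `IsUnramifiedAtInfinitePlaces.top`).  At `p = 2` this is the
statement that the archimedean places split completely in the cyclotomic `ℤ₂`-tower although its layers are
generated by square roots. [cite: Washington1997, §13.1 Prop. 13.2] -/
theorem isUnramifiedAtInfinitePlaces_layer_layer (κ : ZpExtension K p) (m n : ℕ)
    [Algebra (κ.layer m) (κ.layer n)] [IsScalarTower K (κ.layer m) (κ.layer n)] :
    IsUnramifiedAtInfinitePlaces (κ.layer m) (κ.layer n) := by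
  haveI : IsUnramifiedAtInfinitePlaces K (κ.layer n) := κ.isUnramifiedAtInfinitePlaces_layer n
  exact IsUnramifiedAtInfinitePlaces.top K (κ.layer m) (κ.layer n)

/-! ### Door U: `p ∤ h_K` and the unit norm index of the first layer -/

/-- **`e_1 = 0` from the unit norm index of the first layer, every prime `p`.**  For a number field `K`, a
prime `p ∤ h_K`, `s` primes of `K` above `p`, and a `ℤ_p`-extension `κ` whose first layer `K₁ = κ.layer 1`
satisfies `p^s ∣ [E_K : E_K ∩ N_{K₁/K} K₁ˣ] · p` (norm index divisible by `p^{s-1}`): `ord_p h(K₁) = 0`.  (`K₁/K` is Galois of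
degree `p`, unramified at infinity for every `p`, and at most `s` primes ramify in it; then §1.)  The `p`-odd
tree version is `classNumberPExp_one_eq_zero_of_relIndex_mul_eq`. [cite: Lang1990, Ch. 13 §4, Lemma 4.1 (PDF p. 203)]
[cite: Washington1997, §13.1 Prop. 13.2] -/
theorem classNumberPExp_one_eq_zero_of_pow_dvd_relIndex_mul (κ : ZpExtension K p)
    (hK : ¬ p ∣ classNumber K) {s : ℕ}
    (hs : {v : HeightOneSpectrum (𝓞 K) | ((p : ℕ) : 𝓞 K) ∈ v.asIdeal}.ncard = s)
    (hidx : haveI : FiniteDimensional K (κ.layer 1) := κ.finiteDimensional_layer_holds 1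
      p ^ s ∣ (unitsE (κ.layer 1) ⊓ (⊤ : Subgroup (κ.layer 1)ˣ).map
          (Herbrand.norm (κ.layer 1 ≃ₐ[K] κ.layer 1))).relIndex
        (unitsE (κ.layer 1) ⊓ (unitsIncl K (κ.layer 1)).range) * p) :
    classNumberPExp κ 1 = 0 := by
  haveI : FiniteDimensional K (κ.layer 1) := κ.finiteDimensional_layer_holds 1
  haveI : IsGalois K (κ.layer 1) := κ.isGalois_layer_holds 1
  haveI : NumberField (κ.layer 1) := NumberField.of_module_finite K (κ.layer 1)
  haveI : IsUnramifiedAtInfinitePlaces K (κ.layer 1) := κ.isUnramifiedAtInfinitePlaces_layer 1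
  have hp : p.Prime := Fact.out
  have hdeg : Module.finrank K (κ.layer 1) = p := by rw [κ.finrank_layer_holds 1, pow_one]
  rw [classNumberPExp_eq_padicValNat_classNumber]
  refine padicValNat.eq_zero_of_not_dvd ?_
  exact not_dvd_classNumber_of_pow_dvd_relIndex_mul hp hdeg hK
    (ncard_ramified_layer_le_of_ncard_eq κ 1 hs) hidx

/-- **Door U, every prime, unconditional: `A_n = 0` for every `n`.**  For a number field `K`, ANY prime `p`, a
`ℤ_p`-extension `κ` with Fukuda's index `n₀ = 0` (`TotallyRamifiedFrom κ 0`), `p ∤ h_K`, `s` primes above `p`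
and first-layer unit norm index divisible by `p^{s-1}` (`p^s ∣ [E_K : E_K ∩ N_{K₁/K} K₁ˣ] · p`): `e_n(κ) = ord_p h(K_n) = 0`
for all `n` — `e_0 = e_1 = 0`, then Fukuda's Thm. 1 (1), a tree THEOREM
(`fukuda1994_thm1_classNumberPExp_const_of_succ_eq_holds`).  Removes both `p ≠ 2` and the Fukuda hypothesis
from the tree's `classNumberPExp_eq_zero_of_relIndex_mul_eq`. [cite: Lang1990, Ch. 13 §4, Lemma 4.1 (PDF p. 203)]
[cite: Fukuda1994, Thm. 1 (1), p. 264] [cite: Greenberg2001IwasawaPastPresent, Prop. 2.1 p. 339 (s = 1)] -/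
theorem classNumberPExp_eq_zero_of_pow_dvd_relIndex_mul (κ : ZpExtension K p)
    (hram : TotallyRamifiedFrom κ 0) (hK : ¬ p ∣ classNumber K) {s : ℕ}
    (hs : {v : HeightOneSpectrum (𝓞 K) | ((p : ℕ) : 𝓞 K) ∈ v.asIdeal}.ncard = s)
    (hidx : haveI : FiniteDimensional K (κ.layer 1) := κ.finiteDimensional_layer_holds 1
      p ^ s ∣ (unitsE (κ.layer 1) ⊓ (⊤ : Subgroup (κ.layer 1)ˣ).map
          (Herbrand.norm (κ.layer 1 ≃ₐ[K] κ.layer 1))).relIndex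
        (unitsE (κ.layer 1) ⊓ (unitsIncl K (κ.layer 1)).range) * p) (n : ℕ) :
    classNumberPExp κ n = 0 := by
  have h0 : classNumberPExp κ 0 = 0 := by
    rw [classNumberPExp_zero_eq_padicValNat_classNumber]
    exact padicValNat.eq_zero_of_not_dvd hK
  have h1 := classNumberPExp_one_eq_zero_of_pow_dvd_relIndex_mul κ hK hs hidx
  exact classNumberPExp_eq_zero_of_succ_eq_zero fukuda1994_thm1_classNumberPExp_const_of_succ_eq_holds κ
    hram le_rfl h0 h1 (Nat.zero_le n)

/-- Corollary (growth form, every prime, unconditional): under the hypotheses of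
`classNumberPExp_eq_zero_of_pow_dvd_relIndex_mul`, `μ = 0` (`λ = ν = 0`, `n₀ = 0`), i.e.
`ClassicalMuVanishes κ`. [cite: Lang1990, Ch. 13 §4, Lemma 4.1 (PDF p. 203)] [cite: Fukuda1994, Thm. 1 (1), p. 264] -/
theorem classicalMuVanishes_of_pow_dvd_relIndex_mul (κ : ZpExtension K p)
    (hram : TotallyRamifiedFrom κ 0) (hK : ¬ p ∣ classNumber K) {s : ℕ}
    (hs : {v : HeightOneSpectrum (𝓞 K) | ((p : ℕ) : 𝓞 K) ∈ v.asIdeal}.ncard = s)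
    (hidx : haveI : FiniteDimensional K (κ.layer 1) := κ.finiteDimensional_layer_holds 1
      p ^ s ∣ (unitsE (κ.layer 1) ⊓ (⊤ : Subgroup (κ.layer 1)ˣ).map
          (Herbrand.norm (κ.layer 1 ≃ₐ[K] κ.layer 1))).relIndex
        (unitsE (κ.layer 1) ⊓ (unitsIncl K (κ.layer 1)).range) * p) :
    ClassicalMuVanishes κ :=
  classicalMuVanishes_of_eventually_const κ (c := 0) (n₀ := 0)
    fun n _ => classNumberPExp_eq_zero_of_pow_dvd_relIndex_mul κ hram hK hs hidx n

/-- Corollary (every prime, unconditional): under the same hypotheses the classical `λ`-invariant vanishes,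
`classicalLambda κ = 0` (the `p`-class numbers are constant — indeed `e_n = 0` — from `n = 0` on).
[cite: Fukuda1994, Thm. 1 (1), p. 264 («μ_p(K/k) = λ_p(K/k) = 0»)] -/
theorem classicalLambda_eq_zero_of_pow_dvd_relIndex_mul (κ : ZpExtension K p)
    (hram : TotallyRamifiedFrom κ 0) (hK : ¬ p ∣ classNumber K) {s : ℕ}
    (hs : {v : HeightOneSpectrum (𝓞 K) | ((p : ℕ) : 𝓞 K) ∈ v.asIdeal}.ncard = s)
    (hidx : haveI : FiniteDimensional K (κ.layer 1) := κ.finiteDimensional_layer_holds 1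
      p ^ s ∣ (unitsE (κ.layer 1) ⊓ (⊤ : Subgroup (κ.layer 1)ˣ).map
          (Herbrand.norm (κ.layer 1 ≃ₐ[K] κ.layer 1))).relIndex
        (unitsE (κ.layer 1) ⊓ (unitsIncl K (κ.layer 1)).range) * p) :
    classicalLambda κ = 0 :=
  classicalLambda_eq_zero_of_eventually_const κ (c := 0) (n₀ := 0)
    fun n _ => classNumberPExp_eq_zero_of_pow_dvd_relIndex_mul κ hram hK hs hidx n

/-- **Consumer form for the `μ`-roads, every prime, unconditional** («`∀ κ` cyclotomic on `K`,
`ClassicalMuVanishes κ`»): if `p ∤ h_K`, `K` has `s` primes above `p`, and every cyclotomic `ℤ_p`-extension of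
`K` has Fukuda's index `0` and first-layer unit norm index divisible by `p^{s-1}`, then every cyclotomic `κ` has `μ = 0`.
[cite: Lang1990, Ch. 13 §4, Lemma 4.1 (PDF p. 203)] [cite: Fukuda1994, Thm. 1 (1), p. 264] -/
theorem forall_classicalMuVanishes_of_pow_dvd_relIndex_mul (hK : ¬ p ∣ classNumber K) {s : ℕ}
    (hs : {v : HeightOneSpectrum (𝓞 K) | ((p : ℕ) : 𝓞 K) ∈ v.asIdeal}.ncard = s)
    (hram : ∀ κ : ZpExtension K p, κ.IsCyclotomic → TotallyRamifiedFrom κ 0)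
    (hidx : ∀ κ : ZpExtension K p, κ.IsCyclotomic →
      haveI : FiniteDimensional K (κ.layer 1) := κ.finiteDimensional_layer_holds 1
      p ^ s ∣ (unitsE (κ.layer 1) ⊓ (⊤ : Subgroup (κ.layer 1)ˣ).map
          (Herbrand.norm (κ.layer 1 ≃ₐ[K] κ.layer 1))).relIndex
        (unitsE (κ.layer 1) ⊓ (unitsIncl K (κ.layer 1)).range) * p) :
    ∀ κ : ZpExtension K p, κ.IsCyclotomic → ClassicalMuVanishes κ :=
  fun κ hκ => classicalMuVanishes_of_pow_dvd_relIndex_mul κ (hram κ hκ) hK hs (hidx κ hκ)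

/-! ### Door UG: the unit norm index and the ramified classes of one layer -/

/-- **`e_1 = ord_p h_K` from the first layer, every prime `p`.**  For a number field `K`, ANY prime `p` and a
`ℤ_p`-extension `κ` whose first layer `K₁ = κ.layer 1` (Galois of degree `p`, unramified at infinity) has exactly
(at most) `s` ramified primes, unit norm index divisible by `p^{s-1}` (`p^s ∣ [E_K : E_K ∩ N_{K₁/K} K₁ˣ] · p`), and the classes of the ramified
primes generating `Cl(K)` modulo `p`-th powers: `ord_p h(K₁) = ord_p h(K)`.  The `p`-odd tree version is
`classNumberPExp_one_eq_padicValNat_classNumber_of_sup_eq_top`. [folklore]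
[cite: Lang1990, Ch. 13 §4, Lemma 4.1 and sequel (PDF pp. 203–204)] [cite: Washington1997, §13.1 Prop. 13.2] -/
theorem classNumberPExp_one_eq_padicValNat_classNumber_of_pow_dvd_of_sup_eq_top (κ : ZpExtension K p)
    {s : ℕ}
    (hs : {v : HeightOneSpectrum (𝓞 K) | v.asIdeal.ramificationIdxIn (𝓞 (κ.layer 1)) ≠ 1}.ncard ≤ s)
    (hidx : haveI : FiniteDimensional K (κ.layer 1) := κ.finiteDimensional_layer_holds 1
      p ^ s ∣ (unitsE (κ.layer 1) ⊓ (⊤ : Subgroup (κ.layer 1)ˣ).map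
          (Herbrand.norm (κ.layer 1 ≃ₐ[K] κ.layer 1))).relIndex
        (unitsE (κ.layer 1) ⊓ (unitsIncl K (κ.layer 1)).range) * p)
    (hgen : Subgroup.closure {c : ClassGroup (𝓞 K) | ∃ v : HeightOneSpectrum (𝓞 K),
        v.asIdeal.ramificationIdxIn (𝓞 (κ.layer 1)) ≠ 1 ∧
          c = ClassGroup.mk0 ⟨v.asIdeal, mem_nonZeroDivisors_of_ne_zero v.ne_bot⟩} ⊔
      (powMonoidHom p : ClassGroup (𝓞 K) →* ClassGroup (𝓞 K)).range = ⊤) :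
    classNumberPExp κ 1 = padicValNat p (classNumber K) := by
  haveI : FiniteDimensional K (κ.layer 1) := κ.finiteDimensional_layer_holds 1
  haveI : IsGalois K (κ.layer 1) := κ.isGalois_layer_holds 1
  haveI : NumberField (κ.layer 1) := NumberField.of_module_finite K (κ.layer 1)
  haveI : IsUnramifiedAtInfinitePlaces K (κ.layer 1) := κ.isUnramifiedAtInfinitePlaces_layer 1
  have hp : p.Prime := Fact.out
  have hdeg : Module.finrank K (κ.layer 1) = p := by rw [κ.finrank_layer_holds 1, pow_one]
  rw [classNumberPExp_eq_padicValNat_classNumber]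
  exact padicValNat_classNumber_eq_of_pow_dvd_relIndex_mul_of_sup_eq_top hp hdeg hs hidx hgen

/-- **`e_{n+1} = e_n` from the layer `K_{n+1}/K_n`, every prime `p`.**  For ANY prime `p`, a `ℤ_p`-extension
`κ` of `K` and `n` (`K_n` a number field), with `K_{n+1}` a `K_n`-algebra compatibly with `K` (e.g. through
`IntermediateField.inclusion (κ.layer_mono _)`): `K_{n+1}/K_n` is Galois of degree `p`
(`IsGalois.tower_top_of_isGalois`, tower law) and unramified at the infinite places
(`isUnramifiedAtInfinitePlaces_layer_layer`); if it has at most `s` ramified primes, unit norm index divisible by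
`p^{s-1}` (`p^s ∣ [E_{K_n} : E_{K_n} ∩ N K_{n+1}ˣ] · p`), and the classes of its ramified primes generate `Cl(K_n)` modulo
`p`-th powers, then `ord_p h(K_{n+1}) = ord_p h(K_n)`.  The `p`-odd tree version is
`classNumberPExp_succ_eq_of_sup_eq_top`; at `p = 2`, `n = 1`, `s = 3` this is the door for the cyclotomic
`ℤ₂`-tower of a cubic field in which `2` splits completely (no door exists at its layer `(0,1)`). [folklore]
[cite: Lang1990, Ch. 13 §4, Lemma 4.1 and sequel (PDF pp. 203–204)] [cite: Washington1997, §13.1 Prop. 13.2] -/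
theorem classNumberPExp_succ_eq_of_pow_dvd_of_sup_eq_top (κ : ZpExtension K p) (n : ℕ)
    [NumberField (κ.layer n)] [Algebra (κ.layer n) (κ.layer (n + 1))]
    [IsScalarTower K (κ.layer n) (κ.layer (n + 1))] {s : ℕ}
    (hs : {w : HeightOneSpectrum (𝓞 (κ.layer n)) |
        w.asIdeal.ramificationIdxIn (𝓞 (κ.layer (n + 1))) ≠ 1}.ncard ≤ s)
    (hidx : haveI : FiniteDimensional K (κ.layer (n + 1)) := κ.finiteDimensional_layer_holds (n + 1)
      haveI : FiniteDimensional (κ.layer n) (κ.layer (n + 1)) :=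
        Module.Finite.of_restrictScalars_finite K _ _
      p ^ s ∣ (unitsE (κ.layer (n + 1)) ⊓ (⊤ : Subgroup (κ.layer (n + 1))ˣ).map
          (Herbrand.norm (κ.layer (n + 1) ≃ₐ[κ.layer n] κ.layer (n + 1)))).relIndex
        (unitsE (κ.layer (n + 1)) ⊓ (unitsIncl (κ.layer n) (κ.layer (n + 1))).range) * p)
    (hgen : Subgroup.closure {c : ClassGroup (𝓞 (κ.layer n)) |
        ∃ w : HeightOneSpectrum (𝓞 (κ.layer n)),
          w.asIdeal.ramificationIdxIn (𝓞 (κ.layer (n + 1))) ≠ 1 ∧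
            c = ClassGroup.mk0 ⟨w.asIdeal, mem_nonZeroDivisors_of_ne_zero w.ne_bot⟩} ⊔
      (powMonoidHom p : ClassGroup (𝓞 (κ.layer n)) →* ClassGroup (𝓞 (κ.layer n))).range = ⊤) :
    classNumberPExp κ (n + 1) = classNumberPExp κ n := by
  haveI : FiniteDimensional K (κ.layer (n + 1)) := κ.finiteDimensional_layer_holds (n + 1)
  haveI : FiniteDimensional K (κ.layer n) := κ.finiteDimensional_layer_holds n
  haveI : FiniteDimensional (κ.layer n) (κ.layer (n + 1)) := Module.Finite.of_restrictScalars_finite K _ _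
  haveI : IsGalois K (κ.layer (n + 1)) := κ.isGalois_layer_holds (n + 1)
  haveI : IsGalois (κ.layer n) (κ.layer (n + 1)) := IsGalois.tower_top_of_isGalois K _ _
  haveI : NumberField (κ.layer (n + 1)) := NumberField.of_module_finite K (κ.layer (n + 1))
  haveI : Module.Free (κ.layer n) (κ.layer (n + 1)) := Module.Free.of_divisionRing _ _
  haveI : IsUnramifiedAtInfinitePlaces (κ.layer n) (κ.layer (n + 1)) :=
    isUnramifiedAtInfinitePlaces_layer_layer κ n (n + 1)
  have hp : p.Prime := Fact.out
  have hdeg : Module.finrank (κ.layer n) (κ.layer (n + 1)) = p := by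
    have h := Module.finrank_mul_finrank K (κ.layer n) (κ.layer (n + 1))
    rw [κ.finrank_layer_holds n, κ.finrank_layer_holds (n + 1), pow_succ] at h
    exact Nat.eq_of_mul_eq_mul_left (pow_pos hp.pos n) h
  rw [classNumberPExp_eq_padicValNat_classNumber, classNumberPExp_eq_padicValNat_classNumber]
  exact padicValNat_classNumber_eq_of_pow_dvd_relIndex_mul_of_sup_eq_top hp hdeg hs hidx hgen

/-- **Door UG in a `ℤ_p`-tower, every prime, unconditional: `e_m = e_n` for all `m ≥ n`.**  Under the
hypotheses of `classNumberPExp_succ_eq_of_pow_dvd_of_sup_eq_top` for the layer `K_{n+1}/K_n` of a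
`ℤ_p`-extension with Fukuda's index `n₀ ≤ n` (`TotallyRamifiedFrom κ n₀`), the `p`-class numbers are constant
from `K_n` on — `e_{n+1} = e_n`, then Fukuda's Thm. 1 (1), a tree THEOREM
(`fukuda1994_thm1_classNumberPExp_const_of_succ_eq_holds`).  Removes both `p ≠ 2` and the Fukuda hypothesis from
the tree's `classNumberPExp_eq_of_le_of_sup_eq_top`. [folklore] [cite: Fukuda1994, Thm. 1 (1), p. 264]
[cite: Lang1990, Ch. 13 §4, Lemma 4.1 and sequel (PDF pp. 203–204)] -/
theorem classNumberPExp_eq_of_le_of_pow_dvd_of_sup_eq_top (κ : ZpExtension K p) {n₀ n : ℕ}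
    (hram : TotallyRamifiedFrom κ n₀) (hn : n₀ ≤ n)
    [NumberField (κ.layer n)] [Algebra (κ.layer n) (κ.layer (n + 1))]
    [IsScalarTower K (κ.layer n) (κ.layer (n + 1))] {s : ℕ}
    (hs : {w : HeightOneSpectrum (𝓞 (κ.layer n)) |
        w.asIdeal.ramificationIdxIn (𝓞 (κ.layer (n + 1))) ≠ 1}.ncard ≤ s)
    (hidx : haveI : FiniteDimensional K (κ.layer (n + 1)) := κ.finiteDimensional_layer_holds (n + 1)
      haveI : FiniteDimensional (κ.layer n) (κ.layer (n + 1)) :=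
        Module.Finite.of_restrictScalars_finite K _ _
      p ^ s ∣ (unitsE (κ.layer (n + 1)) ⊓ (⊤ : Subgroup (κ.layer (n + 1))ˣ).map
          (Herbrand.norm (κ.layer (n + 1) ≃ₐ[κ.layer n] κ.layer (n + 1)))).relIndex
        (unitsE (κ.layer (n + 1)) ⊓ (unitsIncl (κ.layer n) (κ.layer (n + 1))).range) * p)
    (hgen : Subgroup.closure {c : ClassGroup (𝓞 (κ.layer n)) |
        ∃ w : HeightOneSpectrum (𝓞 (κ.layer n)),
          w.asIdeal.ramificationIdxIn (𝓞 (κ.layer (n + 1))) ≠ 1 ∧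
            c = ClassGroup.mk0 ⟨w.asIdeal, mem_nonZeroDivisors_of_ne_zero w.ne_bot⟩} ⊔
      (powMonoidHom p : ClassGroup (𝓞 (κ.layer n)) →* ClassGroup (𝓞 (κ.layer n))).range = ⊤)
    {m : ℕ} (hm : n ≤ m) : classNumberPExp κ m = classNumberPExp κ n :=
  fukuda1994_thm1_classNumberPExp_const_of_succ_eq_holds K p κ n₀ hram n hn
    (classNumberPExp_succ_eq_of_pow_dvd_of_sup_eq_top κ n hs hidx hgen) m hm

/-- **Door UG in a `ℤ_p`-tower: `μ = 0` in growth form, every prime, unconditional** (`λ = 0`, `ν = e_n`,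
threshold `n`): a `ℤ_p`-extension `κ` of `K` with Fukuda's index `n₀ ≤ n` whose layer `K_{n+1}/K_n` has exactly
at most `s` ramified primes, unit norm index divisible by `p^{s-1}` and ramified classes generating `Cl(K_n)` modulo `p` has
`ClassicalMuVanishes κ`. [folklore] [cite: Fukuda1994, Thm. 1 (1), p. 264]
[cite: Lang1990, Ch. 13 §4, Lemma 4.1 and sequel (PDF pp. 203–204)] -/
theorem classicalMuVanishes_of_pow_dvd_of_sup_eq_top (κ : ZpExtension K p) {n₀ n : ℕ}
    (hram : TotallyRamifiedFrom κ n₀) (hn : n₀ ≤ n)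
    [NumberField (κ.layer n)] [Algebra (κ.layer n) (κ.layer (n + 1))]
    [IsScalarTower K (κ.layer n) (κ.layer (n + 1))] {s : ℕ}
    (hs : {w : HeightOneSpectrum (𝓞 (κ.layer n)) |
        w.asIdeal.ramificationIdxIn (𝓞 (κ.layer (n + 1))) ≠ 1}.ncard ≤ s)
    (hidx : haveI : FiniteDimensional K (κ.layer (n + 1)) := κ.finiteDimensional_layer_holds (n + 1)
      haveI : FiniteDimensional (κ.layer n) (κ.layer (n + 1)) :=
        Module.Finite.of_restrictScalars_finite K _ _
      p ^ s ∣ (unitsE (κ.layer (n + 1)) ⊓ (⊤ : Subgroup (κ.layer (n + 1))ˣ).map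
          (Herbrand.norm (κ.layer (n + 1) ≃ₐ[κ.layer n] κ.layer (n + 1)))).relIndex
        (unitsE (κ.layer (n + 1)) ⊓ (unitsIncl (κ.layer n) (κ.layer (n + 1))).range) * p)
    (hgen : Subgroup.closure {c : ClassGroup (𝓞 (κ.layer n)) |
        ∃ w : HeightOneSpectrum (𝓞 (κ.layer n)),
          w.asIdeal.ramificationIdxIn (𝓞 (κ.layer (n + 1))) ≠ 1 ∧
            c = ClassGroup.mk0 ⟨w.asIdeal, mem_nonZeroDivisors_of_ne_zero w.ne_bot⟩} ⊔
      (powMonoidHom p : ClassGroup (𝓞 (κ.layer n)) →* ClassGroup (𝓞 (κ.layer n))).range = ⊤) :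
    ClassicalMuVanishes κ :=
  classicalMuVanishes_of_eventually_const κ (c := classNumberPExp κ n) (n₀ := n)
    fun _ hm => classNumberPExp_eq_of_le_of_pow_dvd_of_sup_eq_top κ hram hn hs hidx hgen hm

/-- Corollary (every prime, unconditional): under the same hypotheses the classical `λ`-invariant vanishes,
`classicalLambda κ = 0` (the `p`-class numbers are constant from `K_n` on).
[cite: Fukuda1994, Thm. 1 (1), p. 264 («μ_p(K/k) = λ_p(K/k) = 0»)] -/
theorem classicalLambda_eq_zero_of_pow_dvd_of_sup_eq_top (κ : ZpExtension K p) {n₀ n : ℕ}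
    (hram : TotallyRamifiedFrom κ n₀) (hn : n₀ ≤ n)
    [NumberField (κ.layer n)] [Algebra (κ.layer n) (κ.layer (n + 1))]
    [IsScalarTower K (κ.layer n) (κ.layer (n + 1))] {s : ℕ}
    (hs : {w : HeightOneSpectrum (𝓞 (κ.layer n)) |
        w.asIdeal.ramificationIdxIn (𝓞 (κ.layer (n + 1))) ≠ 1}.ncard ≤ s)
    (hidx : haveI : FiniteDimensional K (κ.layer (n + 1)) := κ.finiteDimensional_layer_holds (n + 1)
      haveI : FiniteDimensional (κ.layer n) (κ.layer (n + 1)) :=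
        Module.Finite.of_restrictScalars_finite K _ _
      p ^ s ∣ (unitsE (κ.layer (n + 1)) ⊓ (⊤ : Subgroup (κ.layer (n + 1))ˣ).map
          (Herbrand.norm (κ.layer (n + 1) ≃ₐ[κ.layer n] κ.layer (n + 1)))).relIndex
        (unitsE (κ.layer (n + 1)) ⊓ (unitsIncl (κ.layer n) (κ.layer (n + 1))).range) * p)
    (hgen : Subgroup.closure {c : ClassGroup (𝓞 (κ.layer n)) |
        ∃ w : HeightOneSpectrum (𝓞 (κ.layer n)),
          w.asIdeal.ramificationIdxIn (𝓞 (κ.layer (n + 1))) ≠ 1 ∧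
            c = ClassGroup.mk0 ⟨w.asIdeal, mem_nonZeroDivisors_of_ne_zero w.ne_bot⟩} ⊔
      (powMonoidHom p : ClassGroup (𝓞 (κ.layer n)) →* ClassGroup (𝓞 (κ.layer n))).range = ⊤) :
    classicalLambda κ = 0 :=
  classicalLambda_eq_zero_of_eventually_const κ (c := classNumberPExp κ n) (n₀ := n)
    fun _ hm => classNumberPExp_eq_of_le_of_pow_dvd_of_sup_eq_top κ hram hn hs hidx hgen hm

end Literature.NumberTheory.IwasawaTheory

end
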